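import Mathlib

/-!
# A2Bidegree — the Hodge-type bookkeeping of Prop. A8.1, Steps 2–3

route/T4-A2-p6.md (cell pub-hodge-repro2, Tier 4, sub-claim A2), Prop. A8.1: «Step 2 (Hodge types). By
Lemma A0.5, `L_σ ⊂ H^{2,0}(A_a × A_b)` if `σ ∈ T_a ∩ T_b` … (the Hodge type of a wedge is the sum of the
types; A0.3(iii)). Step 3 … `f_{ab}^*` preserves Hodge types (A0.3(iv)), so
`c ∪ f_{ab}^*(L_σ) ⊂ H^{1,1}(S) ∪ H^{2,0}(S) ⊂ H^{3,1}(S) = 0` (`S` has complex dimension `2`, so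
`H^{p,q}(S) = 0` for `p > 2`).»

Kernel-checked form: a bigraded commutative ring `𝒜 : ℕ × ℕ → Submodule ℚ A` (the Hodge decomposition
`H^*(X, ℂ) = ⊕ H^{p,q}` as a grading by bidegree; only the multiplicativity `𝒜 i * 𝒜 j ⊆ 𝒜 (i + j)` of
`SetLike.GradedMul` is used), a second one `ℬ` for the source of a pull-back, a ring homomorphism
`φ : B →+* A` respecting the bidegrees (A0.3(iv)), and the surface hypothesis `𝒜 (p, q) = ⊥` for `p > 2`.
Then: the product of two `(1,0)`-classes is a `(2,0)`-class (`mul_mem_two_zero`), and a `(1,1)`-class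
times the pull-back of a `(2,0)`-class is `0` (`mul_pull_eq_zero`, `mul_pull_mul_eq_zero`). The Hodge
decomposition itself, Lemma A0.5 and the identification of `L_σ` are not constructed here.
-/

namespace Summit.Ventures.HodgeRepro2.A2Bidegree

variable {A B : Type*} [CommRing A] [CommRing B] [Algebra ℚ A] [Algebra ℚ B]
  (𝒜 : ℕ × ℕ → Submodule ℚ A) (ℬ : ℕ × ℕ → Submodule ℚ B)
  [SetLike.GradedMul 𝒜] [SetLike.GradedMul ℬ]

/-- A0.3(iii): the Hodge type of a wedge is the sum of the types — two `(1,0)`-classes multiply to a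
`(2,0)`-class (the case `σ ∈ T_a ∩ T_b` of Step 2: `L_σ = ℓ_{a,σ} ∧ ℓ_{b,σ} ⊂ H^{2,0}`). -/
theorem mul_mem_two_zero {e e' : B} (he : e ∈ ℬ (1, 0)) (he' : e' ∈ ℬ (1, 0)) :
    e * e' ∈ ℬ (2, 0) :=
  SetLike.mul_mem_graded he he'

/-- A0.3(iii), the mixed case of Step 2: a `(1,0)`-class times a `(0,1)`-class is a `(1,1)`-class
(`σ ∈ T_a Δ T_b`). -/
theorem mul_mem_one_one {e e' : B} (he : e ∈ ℬ (1, 0)) (he' : e' ∈ ℬ (0, 1)) :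
    e * e' ∈ ℬ (1, 1) :=
  SetLike.mul_mem_graded he he'

/-- A0.3(iii), the third case of Step 2: two `(0,1)`-classes multiply to a `(0,2)`-class
(`σ ∉ T_a ∪ T_b`). -/
theorem mul_mem_zero_two {e e' : B} (he : e ∈ ℬ (0, 1)) (he' : e' ∈ ℬ (0, 1)) :
    e * e' ∈ ℬ (0, 2) :=
  SetLike.mul_mem_graded he he'

/-- On a surface (`𝒜 (p, q) = ⊥` for `p > 2`), a `(1,1)`-class times a `(2,0)`-class vanishes
(`H^{1,1} ∪ H^{2,0} ⊂ H^{3,1} = 0`). -/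
theorem mul_eq_zero_of_one_one_of_two_zero (hsurf : ∀ p q : ℕ, 2 < p → 𝒜 (p, q) = ⊥)
    {c w : A} (hc : c ∈ 𝒜 (1, 1)) (hw : w ∈ 𝒜 (2, 0)) : c * w = 0 := by
  have h : c * w ∈ 𝒜 (3, 1) := SetLike.mul_mem_graded hc hw
  rw [hsurf 3 1 (by norm_num)] at h
  exact (Submodule.mem_bot ℚ).1 h

omit [SetLike.GradedMul ℬ] in
/-- Step 3, first half: for a pull-back `φ` respecting bidegrees (A0.3(iv)) and a `(1,1)`-class `c` of
the surface, `c · φ(w) = 0` for every `(2,0)`-class `w` of the source. -/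
theorem mul_pull_eq_zero (hsurf : ∀ p q : ℕ, 2 < p → 𝒜 (p, q) = ⊥) (φ : B →+* A)
    (hφ : ∀ (i : ℕ × ℕ) (b : B), b ∈ ℬ i → φ b ∈ 𝒜 i) {c : A} (hc : c ∈ 𝒜 (1, 1)) {w : B}
    (hw : w ∈ ℬ (2, 0)) : c * φ w = 0 :=
  mul_eq_zero_of_one_one_of_two_zero 𝒜 hsurf hc (hφ _ w hw)

/-- Step 3 for `w = pr_a^* e_{a,σ} ∧ pr_b^* e_{b,σ}` with `σ ∈ T_a ∩ T_b`: the product of a `(1,1)`-class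
of the surface with the pull-back of a wedge of two `(1,0)`-classes is `0`; since `φ` is a ring
homomorphism this is `c · φ(e) · φ(e') = 0`, i.e. `c ∪ f_a^* e_{a,σ} ∧ f_b^* e_{b,σ} = 0` before
integrating. -/
theorem mul_pull_mul_eq_zero (hsurf : ∀ p q : ℕ, 2 < p → 𝒜 (p, q) = ⊥) (φ : B →+* A)
    (hφ : ∀ (i : ℕ × ℕ) (b : B), b ∈ ℬ i → φ b ∈ 𝒜 i) {c : A} (hc : c ∈ 𝒜 (1, 1)) {e e' : B}
    (he : e ∈ ℬ (1, 0)) (he' : e' ∈ ℬ (1, 0)) : c * (φ e * φ e') = 0 := by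
  rw [← map_mul]
  exact mul_pull_eq_zero 𝒜 ℬ hsurf φ hφ hc (mul_mem_two_zero ℬ he he')

end Summit.Ventures.HodgeRepro2.A2Bidegree
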